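import Summits.Ventures.HodgeRepro2.T5HaarCircle

/-!
# The two-torus orbital integral of a coefficient of weight vectors, for any unitary representation (support, seat p1)

`T7SupportBergmanTorusOrbital` / `T7SupportBergmanConjTorus` compute the «two-torus orbital integral» of a
`K`-finite coefficient in the Bergman model of `SU(1,1)`. The computation uses only two things — the
unitarity of the representation and the fact that the two vectors are WEIGHT VECTORS for the two tori — so it
holds for every unitary representation `τ : G →* (V →ₗ[ℂ] V)` of any group `G` on a complex inner-product
space `V` (finite-dimensional or not), with the tori given by homomorphisms `ρ_A, ρ_B : Circle →* G`:

  `coeff τ x_B x_A (ρ_A(u) · γ · ρ_B(v)) = u^a · v^b · coeff τ x_B x_A γ`   (`coeff_torus_mul_mul_torus`)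

for `x_A` of weight `a` under `ρ_A` and `x_B` of weight `b` under `ρ_B` (`coeff τ x y g := ⟪y, τ g x⟫`, linear in
`x` — the convention of the Bergman rows, where `⟨π_k(rot u · g · rot v) zᵐ, zⁿ⟩_k = u^{−(k+2n)} v^{−(k+2m)} ⟨π_k(g) zᵐ, zⁿ⟩_k`),
hence, against the normalised Haar measure of the circle,

  `∫_K ∫_K coeff τ x_B x_A (ρ_A(u) γ ρ_B(v)) · u^p · conj(v^q) = [a + p = 0] · [b = q] · coeff τ x_B x_A γ`
  (`torus_orbital_eq`; `torus_orbital_eq_zero_of_ne`, `norm_torus_orbital_le`),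

and for the conjugated second torus `h ρ_B h⁻¹` with the vector `τ(h) x_B` (`isWeightVector_conj`) the value is
`[…] · coeff τ x_B x_A (γ h)` (`torus_orbital_conj_eq`), which at `γ = h⁻¹`, `x_B = x_A ≠ 0` is `‖x_A‖² ≠ 0`
(`torus_orbital_conj_at_inv_ne_zero`). This is the shape the line uses at the COMPACT archimedean place (the
coefficient of a `K`-type of a finite-dimensional representation) and at the rank-one places alike; the
Bergman rows are the case `G = SU(1,1)`, `ρ = rot`, `x = zⁿ`.

Nothing here is about any specific group, the adelic group, or any period.
Blind lane: Mathlib + the HodgeRepro2 prefix only; no sorry; axioms ⊆ {propext, Classical.choice, Quot.sound}.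
-/

namespace Summit.Ventures.HodgeRepro2.T7SupportWeightTorusOrbital

open MeasureTheory
open scoped InnerProductSpace
open T5HaarCircle

variable {G : Type*} [Group G] {V : Type*} [NormedAddCommGroup V] [InnerProductSpace ℂ V]

/-! ### Unitary representations, coefficients, weight vectors -/

/-- a representation by linear maps preserving the inner product -/
def IsUnitaryRep (τ : G →* (V →ₗ[ℂ] V)) : Prop := ∀ (g : G) (x y : V), ⟪τ g x, τ g y⟫_ℂ = ⟪x, y⟫_ℂ

/-- the matrix coefficient `g ↦ ⟪y, τ(g) x⟫` (linear in `x`, conjugate-linear in `y`) -/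
noncomputable def coeff (τ : G →* (V →ₗ[ℂ] V)) (x y : V) (g : G) : ℂ := ⟪y, τ g x⟫_ℂ

/-- `x` is a weight vector of weight `a` for the torus `ρ : Circle →* G` -/
def IsWeightVector (τ : G →* (V →ₗ[ℂ] V)) (ρ : Circle →* G) (a : ℤ) (x : V) : Prop :=
  ∀ u : Circle, τ (ρ u) x = ((u : ℂ) ^ a) • x

/-- `τ(g)⁻¹ = τ(g⁻¹)` on vectors -/
theorem apply_inv_apply (τ : G →* (V →ₗ[ℂ] V)) (g : G) (x : V) : τ g (τ g⁻¹ x) = x := by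
  rw [← Module.End.mul_apply, ← map_mul, mul_inv_cancel, map_one, Module.End.one_apply]

/-- unitarity as an adjoint relation: `⟪y, τ(g) x⟫ = ⟪τ(g⁻¹) y, x⟫` -/
theorem inner_apply_eq_inner_inv {τ : G →* (V →ₗ[ℂ] V)} (hτ : IsUnitaryRep τ) (g : G) (x y : V) :
    ⟪y, τ g x⟫_ℂ = ⟪τ g⁻¹ y, x⟫_ℂ := by
  have := hτ g (τ g⁻¹ y) x
  rw [apply_inv_apply] at this
  exact this

/-- `conj(u⁻¹ ^ a) = u ^ a` on the circle -/
theorem conj_inv_zpow (u : Circle) (a : ℤ) : (starRingEnd ℂ) (((u⁻¹ : Circle) : ℂ) ^ a) = (u : ℂ) ^ a := by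
  rw [map_zpow₀, Circle.coe_inv_eq_conj, Complex.conj_conj]

/-- a weight vector of the second torus, transported by `h`, is a weight vector of the conjugated torus -/
theorem isWeightVector_conj (τ : G →* (V →ₗ[ℂ] V)) (ρ : Circle →* G) (a : ℤ) (x : V)
    (hx : IsWeightVector τ ρ a x) (h : G) :
    IsWeightVector τ ((MulAut.conj h).toMonoidHom.comp ρ) a (τ h x) := by
  intro u
  simp only [MonoidHom.coe_comp, MulEquiv.coe_toMonoidHom, Function.comp_apply, MulAut.conj_apply]
  rw [map_mul, map_mul, Module.End.mul_apply, Module.End.mul_apply, ← Module.End.mul_apply (τ h⁻¹) (τ h),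
    ← map_mul, inv_mul_cancel, map_one, Module.End.one_apply, hx u, map_smul]

/-! ### The bi-torus equivariance -/

/-- **bi-torus equivariance of a coefficient of weight vectors**:
`coeff (ρ_A(u) γ ρ_B(v)) = u^a v^b coeff γ`. -/
theorem coeff_torus_mul_mul_torus {τ : G →* (V →ₗ[ℂ] V)} (hτ : IsUnitaryRep τ) {ρA ρB : Circle →* G}
    {a b : ℤ} {xA xB : V} (hA : IsWeightVector τ ρA a xA) (hB : IsWeightVector τ ρB b xB) (u v : Circle)
    (γ : G) : coeff τ xB xA (ρA u * γ * ρB v) = (u : ℂ) ^ a * (v : ℂ) ^ b * coeff τ xB xA γ := by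
  unfold coeff
  rw [map_mul, map_mul, Module.End.mul_apply, Module.End.mul_apply, hB v, map_smul, map_smul,
    inner_smul_right, inner_apply_eq_inner_inv hτ, ← map_inv, hA u⁻¹, inner_smul_left, conj_inv_zpow]
  ring

/-! ### The orbital integrals -/

variable [MeasurableSpace Circle] [BorelSpace Circle]

/-- the inner integral (over the second torus) -/
theorem inner_integral {τ : G →* (V →ₗ[ℂ] V)} (hτ : IsUnitaryRep τ) {ρA ρB : Circle →* G} {a b : ℤ}
    {xA xB : V} (hA : IsWeightVector τ ρA a xA) (hB : IsWeightVector τ ρB b xB) (u : Circle) (γ : G)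
    (p q : ℤ) :
    ∫ v : Circle, coeff τ xB xA (ρA u * γ * ρB v) * ((u : ℂ) ^ p * (starRingEnd ℂ) ((v : ℂ) ^ q))
        ∂haarCircle =
      (if b = q then 1 else 0) * ((u : ℂ) ^ (a + p) * coeff τ xB xA γ) := by
  have e : ∀ v : Circle, coeff τ xB xA (ρA u * γ * ρB v) * ((u : ℂ) ^ p * (starRingEnd ℂ) ((v : ℂ) ^ q)) =
      ((u : ℂ) ^ (a + p) * coeff τ xB xA γ) * ((v : ℂ) ^ b * (starRingEnd ℂ) ((v : ℂ) ^ q)) := by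
    intro v
    rw [coeff_torus_mul_mul_torus hτ hA hB u v γ, zpow_add₀ (Circle.coe_ne_zero u)]
    ring
  simp_rw [e]
  rw [integral_const_mul, integral_zpow_mul_conj_zpow]
  ring

/-- **the two-torus orbital integral of a coefficient of weight vectors**:
`∫∫ coeff (ρ_A(u) γ ρ_B(v)) · u^p · conj(v^q) = [a + p = 0] · [b = q] · coeff γ`. -/
theorem torus_orbital_eq {τ : G →* (V →ₗ[ℂ] V)} (hτ : IsUnitaryRep τ) {ρA ρB : Circle →* G} {a b : ℤ}
    {xA xB : V} (hA : IsWeightVector τ ρA a xA) (hB : IsWeightVector τ ρB b xB) (γ : G) (p q : ℤ) :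
    ∫ u : Circle, ∫ v : Circle,
        coeff τ xB xA (ρA u * γ * ρB v) * ((u : ℂ) ^ p * (starRingEnd ℂ) ((v : ℂ) ^ q))
        ∂haarCircle ∂haarCircle =
      (if a + p = 0 then 1 else 0) * (if b = q then 1 else 0) * coeff τ xB xA γ := by
  simp_rw [inner_integral hτ hA hB _ γ p q]
  have e : ∀ u : Circle, (if b = q then (1 : ℂ) else 0) * ((u : ℂ) ^ (a + p) * coeff τ xB xA γ) =
      ((if b = q then (1 : ℂ) else 0) * coeff τ xB xA γ) *
        ((u : ℂ) ^ (a + p) * (starRingEnd ℂ) ((u : ℂ) ^ (0 : ℤ))) := by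
    intro u
    simp only [zpow_zero, map_one, mul_one]
    ring
  simp_rw [e]
  rw [integral_const_mul, integral_zpow_mul_conj_zpow]
  ring

/-- the orbital integral vanishes unless the torus characters match the weights (`p = −a`, `q = b`) -/
theorem torus_orbital_eq_zero_of_ne {τ : G →* (V →ₗ[ℂ] V)} (hτ : IsUnitaryRep τ) {ρA ρB : Circle →* G}
    {a b : ℤ} {xA xB : V} (hA : IsWeightVector τ ρA a xA) (hB : IsWeightVector τ ρB b xB) (γ : G) (p q : ℤ)
    (h : ¬ (a + p = 0 ∧ b = q)) :
    ∫ u : Circle, ∫ v : Circle,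
        coeff τ xB xA (ρA u * γ * ρB v) * ((u : ℂ) ^ p * (starRingEnd ℂ) ((v : ℂ) ^ q))
        ∂haarCircle ∂haarCircle = 0 := by
  rw [torus_orbital_eq hτ hA hB γ p q]
  by_cases hp : a + p = 0
  · have hq : ¬ b = q := fun hq => h ⟨hp, hq⟩
    rw [if_neg hq]
    ring
  · rw [if_neg hp]
    ring

/-- **the orbital integral is bounded by the coefficient** -/
theorem norm_torus_orbital_le {τ : G →* (V →ₗ[ℂ] V)} (hτ : IsUnitaryRep τ) {ρA ρB : Circle →* G}
    {a b : ℤ} {xA xB : V} (hA : IsWeightVector τ ρA a xA) (hB : IsWeightVector τ ρB b xB) (γ : G) (p q : ℤ) :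
    ‖∫ u : Circle, ∫ v : Circle,
        coeff τ xB xA (ρA u * γ * ρB v) * ((u : ℂ) ^ p * (starRingEnd ℂ) ((v : ℂ) ^ q))
        ∂haarCircle ∂haarCircle‖ ≤ ‖coeff τ xB xA γ‖ := by
  rw [torus_orbital_eq hτ hA hB γ p q, norm_mul, norm_mul]
  have h1 : ‖(if a + p = 0 then (1 : ℂ) else 0)‖ ≤ 1 := by
    split_ifs <;> simp
  have h2 : ‖(if b = q then (1 : ℂ) else 0)‖ ≤ 1 := by
    split_ifs <;> simp
  calc ‖(if a + p = 0 then (1 : ℂ) else 0)‖ * ‖(if b = q then (1 : ℂ) else 0)‖ * ‖coeff τ xB xA γ‖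
      ≤ 1 * 1 * ‖coeff τ xB xA γ‖ := by gcongr
    _ = ‖coeff τ xB xA γ‖ := by ring

/-! ### The conjugated second torus -/

omit [MeasurableSpace Circle] [BorelSpace Circle] in
/-- the coefficient of the transported vector: `coeff (τ(h) x) y γ = coeff x y (γ h)` -/
theorem coeff_apply_left (τ : G →* (V →ₗ[ℂ] V)) (x y : V) (h γ : G) :
    coeff τ (τ h x) y γ = coeff τ x y (γ * h) := by
  unfold coeff
  rw [map_mul, Module.End.mul_apply]

omit [MeasurableSpace Circle] [BorelSpace Circle] in
/-- the group identity behind the conjugated torus -/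
theorem conj_torus_mul (ρB : Circle →* G) (u v : Circle) (ρA : Circle →* G) (γ h : G) :
    ρA u * γ * ((MulAut.conj h).toMonoidHom.comp ρB) v =
      ρA u * γ * (h * ρB v * h⁻¹) := by
  simp [MulAut.conj_apply]

/-- **the orbital integral for the tori `ρ_A` and `h ρ_B h⁻¹`** (vectors `τ(h) x_B`, `x_A`) is the
`ρ_A × ρ_B` orbital integral of `γ h`: `[a + p = 0] · [b = q] · coeff x_B x_A (γ h)`. -/
theorem torus_orbital_conj_eq {τ : G →* (V →ₗ[ℂ] V)} (hτ : IsUnitaryRep τ) {ρA ρB : Circle →* G}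
    {a b : ℤ} {xA xB : V} (hA : IsWeightVector τ ρA a xA) (hB : IsWeightVector τ ρB b xB) (h γ : G)
    (p q : ℤ) :
    ∫ u : Circle, ∫ v : Circle,
        coeff τ (τ h xB) xA (ρA u * γ * (h * ρB v * h⁻¹)) * ((u : ℂ) ^ p * (starRingEnd ℂ) ((v : ℂ) ^ q))
        ∂haarCircle ∂haarCircle =
      (if a + p = 0 then 1 else 0) * (if b = q then 1 else 0) * coeff τ xB xA (γ * h) := by
  have e : ∀ (u v : Circle), coeff τ (τ h xB) xA (ρA u * γ * (h * ρB v * h⁻¹)) =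
      coeff τ (τ h xB) xA (ρA u * γ * ((MulAut.conj h).toMonoidHom.comp ρB) v) := by
    intro u v
    rw [conj_torus_mul]
  simp_rw [e]
  rw [torus_orbital_eq hτ hA (isWeightVector_conj τ ρB b xB hB h) γ p q, coeff_apply_left]

/-- **`‖x_A‖² ≠ 0`**: at `γ = h⁻¹`, `x_B = x_A ≠ 0` and matching characters the orbital integral of the
conjugated torus is `⟪x_A, x_A⟫ ≠ 0`. -/
theorem torus_orbital_conj_at_inv_ne_zero {τ : G →* (V →ₗ[ℂ] V)} (hτ : IsUnitaryRep τ) {ρA ρB : Circle →* G}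
    {a b : ℤ} {xA : V} (hA : IsWeightVector τ ρA a xA) (hB : IsWeightVector τ ρB b xA) (hxA : xA ≠ 0)
    (h : G) :
    ∫ u : Circle, ∫ v : Circle,
        coeff τ (τ h xA) xA (ρA u * h⁻¹ * (h * ρB v * h⁻¹)) * ((u : ℂ) ^ (-a) * (starRingEnd ℂ) ((v : ℂ) ^ b))
        ∂haarCircle ∂haarCircle ≠ 0 := by
  rw [torus_orbital_conj_eq hτ hA hB h h⁻¹ (-a) b, if_pos (by ring), if_pos rfl, one_mul, one_mul,
    inv_mul_cancel]
  unfold coeff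
  rw [map_one, Module.End.one_apply]
  exact inner_self_ne_zero.2 hxA

end Summit.Ventures.HodgeRepro2.T7SupportWeightTorusOrbital
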